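import Summits.ResolutionOfSingularities.ResolutionOfSingularities.Theorems.EquisingularLiftEquisingularLiftCubicSurfaceSingularPointsTransport
import Summits.ResolutionOfSingularities.ResolutionOfSingularities.Theorems.EquisingularLiftEquisingularLiftOrdinaryPointsMatrixForm
import Mathlib.LinearAlgebra.Dimension.RankNullity
import Mathlib.LinearAlgebra.Basis.VectorSpace
import Mathlib.LinearAlgebra.FiniteDimensional.Defs
import HarnessLib

/-!
# [OURS] ★★ SINGULAR POINTS OF A CUBIC SURFACE WITH NO SUBMAXIMAL LINE: AT MOST FOUR, IN LINEARLY GENERAL POSITION — every characteristic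
# (cruxes `EquisingularLiftNatThree` stmt-…-20148, `EquisingularLiftNat` stmt-…-20038, `EquisingularLift` stmt-…-15660)

[OURS · leafhand-res-equisingularlift-8 g0, 2026-08-31; cell `pub/decomp-res`] AI-produced, weaker than expert review; NOT a statement of any manuscript;
nothing here proves resolution of singularities in positive characteristic.  DEF-FREE helper; no `sorry`; standard axioms; ZERO named hypotheses.

The classical statement (Cayley–Salmon–Schläfli; Bruce–Wall 1979 §1), classification-free and in ALL characteristics: for a PRIME cubic form
`F ∈ K[x₀, …, x₃]` (any field `K`) such that no linear change of coordinates puts `F` in `(x₂, x₃)²` (no line of multiplicity `2`, i.e. `V₊(F)` is not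
singular along a line — the «submaximal line» family already discharged by ✓ `SubmaxLine.*`), the singular vectors (`b ≠ 0`, `F(b) = 0`, `∇F(b) = 0`) are,
up to scalars, among the columns of ONE invertible matrix:

* `false_of_two_singular` / `false_of_three_singular` / `false_of_four_singular` — a singular vector which is a combination with non-zero coefficients
  of `2` / `3` / `4` linearly independent singular vectors is absurd (✓ `CubicNodes.aeval_mem_sq_of_singular_collinear` / `X_dvd_aeval_of_singular_coplanar`
  / `aeval_eq_zero_of_singular_five` after completing to a basis, `exists_linearIndependent_snoc_of_lt_finrank`);
* ★★ `exists_matrix_of_singular` — `∃ B ∈ GL₄(K)`, `S` duplicate-free: the marked columns `B_{·c}` (`c ∈ S`) are singular and EVERY singular vector is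
  proportional to a marked column (a maximal linearly independent set of singular vectors, `exists_maximal_linearIndepOn`, extended to a basis);
* ★★ `exists_normalized_matrix_of_singular` — the same with a chart choice `c₀` normalising `B_{c₀(c), c} = 1` (the input shape of
  ✓ `MultiOrd.elNatAt_of_ordinaryPoints_matrix₂` / ✓ `StrataSplit.blowupModel_of_ordinaryPoints_matrix₂`).

References: [Hartshorne1977, I Ex. 5.8]; J. W. Bruce, C. T. C. Wall, *On the classification of cubic surfaces*, J. London Math. Soc. 19 (1979) §1
(statement); the proof here is the elementary coordinate computation of the companion files.
-/

set_option linter.dupNamespace false -- mandated namespace `Summit.<Summit>.<Problem>` of this single-conjunct summit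

noncomputable section

open MvPolynomial

namespace Summit.ResolutionOfSingularities.ResolutionOfSingularities.Cruxes.EquisingularLiftNat.Sections

namespace CubicNodes

variable {K : Type} [Field K]

/-! ## Scaling and matrices of columns -/

/-- `F(c·z) = c^d·F(z)` for a form of degree `d`. [folklore] -/
theorem eval_smul_eq_pow_mul {N : ℕ} {F : MvPolynomial (Fin N) K} {d : ℕ} (hF : F.IsHomogeneous d) (c : K) (z : Fin N → K) :
    eval (c • z) F = c ^ d * eval z F := by
  classical
  simp only [MvPolynomial.eval_eq, Finset.mul_sum]
  refine Finset.sum_congr rfl fun s hs => ?_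
  have hd : s.degree = d := degree_eq_of_mem_support hF hs
  subst hd
  simp only [Pi.smul_apply, smul_eq_mul, mul_pow, Finset.prod_mul_distrib, Finset.prod_pow_eq_pow_sum, Finsupp.degree_apply]
  ring

/-- Singular vectors of a cubic form are stable under scaling. [folklore] -/
theorem singular_smul {F : MvPolynomial (Fin 4) K} (hF : F.IsHomogeneous 3) (c : K) {b : Fin 4 → K}
    (h0 : eval b F = 0) (hd : ∀ j, eval b (pderiv j F) = 0) :
    eval (c • b) F = 0 ∧ ∀ j, eval (c • b) (pderiv j F) = 0 := by
  refine ⟨by rw [eval_smul_eq_pow_mul hF, h0, mul_zero], fun j => ?_⟩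
  rw [eval_smul_eq_pow_mul (hF.pderiv (i := j)), hd j, mul_zero]

/-- The matrix whose columns are a linearly independent family of four vectors is invertible. [folklore] -/
theorem isUnit_det_of_linearIndependent {w : Fin 4 → Fin 4 → K} (hw : LinearIndependent K w) :
    IsUnit (Matrix.of fun l j => w j l).det := by
  rw [← Matrix.isUnit_iff_isUnit_det, ← Matrix.linearIndependent_cols_iff_isUnit]
  exact hw

/-- The columns of an invertible matrix are non-zero. [folklore] -/
theorem col_ne_zero {N : ℕ} {B : Matrix (Fin N) (Fin N) K} (hB : IsUnit B.det) (j : Fin N) : (fun l => B l j) ≠ 0 := by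
  classical
  intro h
  have hinj := Matrix.mulVec_injective_iff_isUnit.mpr ((Matrix.isUnit_iff_isUnit_det B).mpr hB)
  have h1 : Matrix.mulVec B (Pi.single j 1 : Fin N → K) = Matrix.mulVec B 0 := by
    rw [mulVec_single_one_eq, Matrix.mulVec_zero]; exact h
  have h2 := congrFun (hinj h1) j
  simp at h2

/-- Scaling a linearly independent family by non-zero scalars keeps it linearly independent. [folklore] -/
theorem linearIndependent_smul {n : ℕ} {w : Fin n → Fin 4 → K} (hw : LinearIndependent K w) (c : Fin n → K) (hc : ∀ i, c i ≠ 0) :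
    LinearIndependent K (fun i => c i • w i) := by
  convert hw.units_smul (fun i => Units.mk0 (c i) (hc i)) using 1
  funext i
  simp [Units.smul_def]

/-! ## Two, three, four independent singular vectors and one more in their span -/

/-- ★ **No singular vector is a combination with non-zero coefficients of FOUR independent singular vectors** (five singular points, no four coplanar
⟹ `F ∘ B = 0`). [cite: Hartshorne1977, I Ex. 5.8] -/
theorem false_of_four_singular {F : MvPolynomial (Fin 4) K} (hF : F.IsHomogeneous 3) (hF0 : F ≠ 0)
    (w : Fin 4 → Fin 4 → K) (hw : LinearIndependent K w)
    (hs : ∀ i, eval (w i) F = 0 ∧ ∀ j, eval (w i) (pderiv j F) = 0) (c : Fin 4 → K) (hc : ∀ i, c i ≠ 0)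
    (hsum0 : eval (∑ i, c i • w i) F = 0) (hsumd : ∀ j, eval (∑ i, c i • w i) (pderiv j F) = 0) : False := by
  classical
  set v : Fin 4 → Fin 4 → K := fun i => c i • w i with hv
  have hvind : LinearIndependent K v := linearIndependent_smul hw c hc
  set B : Matrix (Fin 4) (Fin 4) K := Matrix.of fun l j => v j l with hBdef
  have hB : IsUnit B.det := isUnit_det_of_linearIndependent hvind
  have hcol : ∀ j, (fun l => B l j) = c j • w j := fun j => rfl
  have hsumv : (fun l => B l 0 + B l 1 + B l 2 + B l 3) = ∑ i, c i • w i := by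
    funext l
    simp only [Finset.sum_apply, Fin.sum_univ_four]
    rfl
  have hG := aeval_eq_zero_of_singular_five B hF (fun i => by rw [hcol]; exact singular_smul hF (c i) (hs i).1 (hs i).2)
    (by rw [hsumv]; exact hsum0) (by rw [hsumv]; exact hsumd)
  exact hF0 (eq_zero_of_aeval_eq_zero hB hG)

/-- ★ **No singular vector is a combination with non-zero coefficients of THREE independent singular vectors of a PRIME cubic form** (four coplanar
singular points, no three collinear ⟹ a plane divides `F`). [cite: Hartshorne1977, I Ex. 5.8] -/
theorem false_of_three_singular {F : MvPolynomial (Fin 4) K} (hF : F.IsHomogeneous 3) (hprime : Prime F)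
    (w : Fin 3 → Fin 4 → K) (hw : LinearIndependent K w)
    (hs : ∀ i, eval (w i) F = 0 ∧ ∀ j, eval (w i) (pderiv j F) = 0) (c : Fin 3 → K) (hc : ∀ i, c i ≠ 0)
    (hsum0 : eval (∑ i, c i • w i) F = 0) (hsumd : ∀ j, eval (∑ i, c i • w i) (pderiv j F) = 0) : False := by
  classical
  have hvind : LinearIndependent K (fun i => c i • w i) := linearIndependent_smul hw c hc
  obtain ⟨x, hx⟩ := exists_linearIndependent_snoc_of_lt_finrank hvind (by rw [Module.finrank_fin_fun]; norm_num)
  set v : Fin 4 → Fin 4 → K := ![c 0 • w 0, c 1 • w 1, c 2 • w 2, x] with hv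
  have hvx : v = Fin.snoc (fun i => c i • w i) x := by
    funext i
    fin_cases i <;> rfl
  have hvind' : LinearIndependent K v := by rw [hvx]; exact hx
  set B : Matrix (Fin 4) (Fin 4) K := Matrix.of fun l j => v j l with hBdef
  have hB : IsUnit B.det := isUnit_det_of_linearIndependent hvind'
  have hcol0 : (fun l => B l 0) = c 0 • w 0 := rfl
  have hcol1 : (fun l => B l 1) = c 1 • w 1 := rfl
  have hcol2 : (fun l => B l 2) = c 2 • w 2 := rfl
  have hsumv : (fun l => B l 0 + B l 1 + B l 2) = ∑ i, c i • w i := by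
    funext l
    simp only [Finset.sum_apply, Fin.sum_univ_three]
    rfl
  have hdvd := X_dvd_aeval_of_singular_coplanar B hF
    (by rw [hcol0]; exact (singular_smul hF (c 0) (hs 0).1 (hs 0).2).1) (by rw [hcol0]; exact (singular_smul hF (c 0) (hs 0).1 (hs 0).2).2)
    (by rw [hcol1]; exact (singular_smul hF (c 1) (hs 1).1 (hs 1).2).1) (by rw [hcol1]; exact (singular_smul hF (c 1) (hs 1).1 (hs 1).2).2)
    (by rw [hcol2]; exact (singular_smul hF (c 2) (hs 2).1 (hs 2).2).1) (by rw [hcol2]; exact (singular_smul hF (c 2) (hs 2).1 (hs 2).2).2)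
    (by rw [hsumv]; exact hsum0) (by rw [hsumv]; exact hsumd)
  have hGprime : Prime (aeval B.toMvPolynomial F) :=
    SubmaxLine.prime_aeval_of_prime (B⁻¹).toMvPolynomial B.toMvPolynomial
      (MultiOrd.aeval_toMvPolynomial_inv_toMvPolynomial B hB) (MultiOrd.aeval_toMvPolynomial_toMvPolynomial_inv B hB) hprime
  exact not_X_dvd_of_prime (Literature.AlgebraicGeometry.ProjectiveSpace.IsHomogeneous.aeval_toMvPolynomial B hF) hGprime 3 hdvd

/-- ★ **No singular vector is a combination with non-zero coefficients of TWO independent singular vectors, when no coordinates put `F` in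
`(x₂, x₃)²`** (three collinear singular points ⟹ the line has multiplicity `2`). [cite: Hartshorne1977, I Ex. 5.8] -/
theorem false_of_two_singular {F : MvPolynomial (Fin 4) K} (hF : F.IsHomogeneous 3)
    (hsub : ∀ B : Matrix (Fin 4) (Fin 4) K, IsUnit B.det →
      aeval B.toMvPolynomial F ∉ (Ideal.span {(X 2 : MvPolynomial (Fin 4) K), X 3}) ^ 2)
    (w : Fin 2 → Fin 4 → K) (hw : LinearIndependent K w)
    (hs : ∀ i, eval (w i) F = 0 ∧ ∀ j, eval (w i) (pderiv j F) = 0) (c : Fin 2 → K) (hc : ∀ i, c i ≠ 0)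
    (hsum0 : eval (∑ i, c i • w i) F = 0) (hsumd : ∀ j, eval (∑ i, c i • w i) (pderiv j F) = 0) : False := by
  classical
  have hvind : LinearIndependent K (fun i => c i • w i) := linearIndependent_smul hw c hc
  obtain ⟨x, hx⟩ := exists_linearIndependent_snoc_of_lt_finrank hvind (by rw [Module.finrank_fin_fun]; norm_num)
  obtain ⟨y, hy⟩ := exists_linearIndependent_snoc_of_lt_finrank hx (by rw [Module.finrank_fin_fun]; norm_num)
  set v : Fin 4 → Fin 4 → K := ![c 0 • w 0, c 1 • w 1, x, y] with hv
  have hvy : v = Fin.snoc (Fin.snoc (fun i => c i • w i) x) y := by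
    funext i
    fin_cases i <;> rfl
  have hvind' : LinearIndependent K v := by rw [hvy]; exact hy
  set B : Matrix (Fin 4) (Fin 4) K := Matrix.of fun l j => v j l with hBdef
  have hB : IsUnit B.det := isUnit_det_of_linearIndependent hvind'
  have hcol0 : (fun l => B l 0) = c 0 • w 0 := rfl
  have hcol1 : (fun l => B l 1) = c 1 • w 1 := rfl
  have hsumv : (fun l => B l 0 + B l 1) = ∑ i, c i • w i := by
    funext l
    simp only [Finset.sum_apply, Fin.sum_univ_two]
    rfl
  have hmem := aeval_mem_sq_of_singular_collinear B hF
    (by rw [hcol0]; exact (singular_smul hF (c 0) (hs 0).1 (hs 0).2).1) (by rw [hcol0]; exact (singular_smul hF (c 0) (hs 0).1 (hs 0).2).2)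
    (by rw [hcol1]; exact (singular_smul hF (c 1) (hs 1).1 (hs 1).2).1) (by rw [hcol1]; exact (singular_smul hF (c 1) (hs 1).1 (hs 1).2).2)
    (by rw [hsumv]; exact hsum0) (by rw [hsumv]; exact hsumd)
  exact hsub B hB hmem

/-! ## ★★ The singular vectors are among the columns of one invertible matrix -/

/-- ★★ **SINGULAR POINTS OF A PRIME CUBIC SURFACE WITH NO LINE OF MULTIPLICITY TWO: AT MOST FOUR, LINEARLY INDEPENDENT** — every characteristic,
any field.  For a prime cubic form `F ∈ K[x₀,…,x₃]` with `F ∘ B ∉ (x₂, x₃)²` for every `B ∈ GL₄(K)`, there are `B ∈ GL₄(K)` and a duplicate-free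
marking `S` of columns such that the marked columns are singular vectors of `F` and every singular vector of `F` is proportional to a marked column.
(A maximal linearly independent set of singular vectors extended to a basis; a further singular vector in their span has `≥ 2` non-zero coordinates and
contradicts ✓ `false_of_two/three/four_singular`.) [cite: Hartshorne1977, I Ex. 5.8] -/
theorem exists_matrix_of_singular {F : MvPolynomial (Fin 4) K} (hF : F.IsHomogeneous 3) (hprime : Prime F)
    (hsub : ∀ B : Matrix (Fin 4) (Fin 4) K, IsUnit B.det →
      aeval B.toMvPolynomial F ∉ (Ideal.span {(X 2 : MvPolynomial (Fin 4) K), X 3}) ^ 2) :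
    ∃ (B : Matrix (Fin 4) (Fin 4) K) (S : List (Fin 4)), IsUnit B.det ∧ S.Nodup ∧
      (∀ c ∈ S, eval (fun l => B l c) F = 0 ∧ ∀ j, eval (fun l => B l c) (pderiv j F) = 0) ∧
      ∀ b : Fin 4 → K, b ≠ 0 → eval b F = 0 → (∀ j, eval b (pderiv j F) = 0) → ∃ c ∈ S, ∃ s : K, b = s • fun l => B l c := by
  classical
  -- the singular vectors and a maximal linearly independent subset `T`
  set Sng : Set (Fin 4 → K) := {b | b ≠ 0 ∧ eval b F = 0 ∧ ∀ j, eval b (pderiv j F) = 0} with hSng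
  obtain ⟨s, hsind, hsmax⟩ := exists_maximal_linearIndepOn K (fun b : Sng => (b : Fin 4 → K))
  set T : Set (Fin 4 → K) := (fun b : Sng => (b : Fin 4 → K)) '' s with hT
  have hTind : LinearIndepOn K id T := hsind.id_image
  have hTsub : T ⊆ Sng := by rintro _ ⟨b, -, rfl⟩; exact b.2
  have hspan : ∀ b ∈ Sng, b ∈ Submodule.span K T := by
    intro b hb
    by_cases hbs : (⟨b, hb⟩ : Sng) ∈ s
    · exact Submodule.subset_span ⟨⟨b, hb⟩, hbs, rfl⟩
    · obtain ⟨a, ha, hab⟩ := hsmax ⟨b, hb⟩ hbs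
      exact (Submodule.smul_mem_iff _ ha).mp hab
  -- extend `T` to a basis, enumerated by `Fin 4`; its vectors are the columns of `B`
  let bE := Module.Basis.extend hTind
  haveI : Fintype (hTind.extend (Set.subset_univ T)) := FiniteDimensional.fintypeBasisIndex bE
  have hcard : Fintype.card (hTind.extend (Set.subset_univ T)) = 4 := by
    rw [← Module.finrank_eq_card_basis bE, Module.finrank_fin_fun]
  let e : Fin 4 ≃ hTind.extend (Set.subset_univ T) := (Fintype.equivFinOfCardEq hcard).symm
  set B : Matrix (Fin 4) (Fin 4) K := Matrix.of fun l j => ((e j : hTind.extend (Set.subset_univ T)) : Fin 4 → K) l with hBdef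
  have hcolB : ∀ j, (fun l => B l j) = ((e j : hTind.extend (Set.subset_univ T)) : Fin 4 → K) := fun j => rfl
  have hBind : LinearIndependent K (fun j => ((e j : hTind.extend (Set.subset_univ T)) : Fin 4 → K)) := by
    have h := bE.linearIndependent
    rw [Module.Basis.coe_extend] at h
    exact h.comp e e.injective
  have hB : IsUnit B.det := isUnit_det_of_linearIndependent hBind
  set S : List (Fin 4) := (Finset.univ.filter fun j => ((e j : hTind.extend (Set.subset_univ T)) : Fin 4 → K) ∈ T).toList
    with hSdef
  have hSmem : ∀ j, j ∈ S ↔ ((e j : hTind.extend (Set.subset_univ T)) : Fin 4 → K) ∈ T := fun j => by simp [hSdef]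
  refine ⟨B, S, hB, Finset.nodup_toList _, fun c hc => ?_, fun b hb0 hbF hbd => ?_⟩
  · have h := hTsub ((hSmem c).mp hc)
    exact ⟨h.2.1, h.2.2⟩
  -- a singular vector `b`: write it on finitely many elements of `T` with non-zero coefficients
  have hb : b ∈ Sng := ⟨hb0, hbF, hbd⟩
  obtain ⟨f, t, htT, -, hsum⟩ := Submodule.mem_span_iff_exists_finset_subset.mp (hspan b hb)
  set t' := t.filter (fun a => f a ≠ 0) with ht'
  have ht'T : ↑t' ⊆ T := fun a ha => htT (Finset.mem_filter.mp ha).1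
  have hsum' : ∑ a ∈ t', f a • a = b := by
    rw [← hsum, ht', Finset.sum_filter]
    exact Finset.sum_congr rfl fun a _ => by by_cases h : f a = 0 <;> simp [h]
  have hft' : ∀ a ∈ t', f a ≠ 0 := fun a ha => (Finset.mem_filter.mp ha).2
  have ht'ind : LinearIndepOn K id (↑t' : Set (Fin 4 → K)) := hTind.mono ht'T
  have hk : t'.card ≤ 4 := by
    have h := LinearIndependent.finset_card_le_finrank (R := K) (M := Fin 4 → K) (b := t') ht'ind
    rwa [Module.finrank_fin_fun] at h
  -- enumerate `t'` by `Fin t'.card`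
  let eq : Fin t'.card ≃ {x // x ∈ t'} := t'.equivFin.symm
  set w : Fin t'.card → Fin 4 → K := fun i => (eq i : Fin 4 → K) with hw
  have hwind : LinearIndependent K w := ht'ind.comp eq eq.injective
  have hwT : ∀ i, w i ∈ T := fun i => ht'T (eq i).2
  have hws : ∀ i, eval (w i) F = 0 ∧ ∀ j, eval (w i) (pderiv j F) = 0 := fun i => ⟨(hTsub (hwT i)).2.1, (hTsub (hwT i)).2.2⟩
  have hwc : ∀ i, f (w i) ≠ 0 := fun i => hft' _ (eq i).2
  have hwsum : ∑ i, f (w i) • w i = b := by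
    rw [← hsum', ← Finset.sum_coe_sort t']
    exact Equiv.sum_comp eq (fun x : {x // x ∈ t'} => f (x : Fin 4 → K) • (x : Fin 4 → K))
  -- case analysis on the number of non-zero coefficients
  obtain h0 | h1 | h2 | h3 | h4 : t'.card = 0 ∨ t'.card = 1 ∨ t'.card = 2 ∨ t'.card = 3 ∨ t'.card = 4 := by omega
  · -- no term: `b = 0`
    rw [Finset.card_eq_zero] at h0
    rw [h0, Finset.sum_empty] at hsum'
    exact absurd hsum'.symm hb0
  · -- one term: `b` is proportional to a marked column
    obtain ⟨a, ha⟩ := Finset.card_eq_one.mp h1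
    rw [ha, Finset.sum_singleton] at hsum'
    have haT : a ∈ T := ht'T (by rw [ha]; exact Finset.mem_singleton_self a)
    have haE : a ∈ hTind.extend (Set.subset_univ T) := hTind.subset_extend _ haT
    refine ⟨e.symm ⟨a, haE⟩, (hSmem _).mpr (by rw [Equiv.apply_symm_apply]; exact haT), f a, ?_⟩
    rw [hcolB, Equiv.apply_symm_apply, ← hsum']
  · -- two terms: three collinear singular points
    exfalso
    let ι : Fin 2 ≃ Fin t'.card := finCongr h2.symm
    refine false_of_two_singular hF hsub (w ∘ ι) (hwind.comp ι ι.injective) (fun i => hws _) (fun i => f (w (ι i)))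
      (fun i => hwc _) ?_ ?_
    · rw [show (∑ i, f (w (ι i)) • (w ∘ ι) i) = b from ?_]; exact hbF
      rw [← hwsum]; exact Equiv.sum_comp ι (fun i => f (w i) • w i)
    · intro j
      rw [show (∑ i, f (w (ι i)) • (w ∘ ι) i) = b from ?_]; exact hbd j
      rw [← hwsum]; exact Equiv.sum_comp ι (fun i => f (w i) • w i)
  · -- three terms: four coplanar singular points, no three collinear
    exfalso
    let ι : Fin 3 ≃ Fin t'.card := finCongr h3.symm
    refine false_of_three_singular hF hprime (w ∘ ι) (hwind.comp ι ι.injective) (fun i => hws _) (fun i => f (w (ι i)))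
      (fun i => hwc _) ?_ ?_
    · rw [show (∑ i, f (w (ι i)) • (w ∘ ι) i) = b from ?_]; exact hbF
      rw [← hwsum]; exact Equiv.sum_comp ι (fun i => f (w i) • w i)
    · intro j
      rw [show (∑ i, f (w (ι i)) • (w ∘ ι) i) = b from ?_]; exact hbd j
      rw [← hwsum]; exact Equiv.sum_comp ι (fun i => f (w i) • w i)
  · -- four terms: five singular points, no four coplanar
    exfalso
    let ι : Fin 4 ≃ Fin t'.card := finCongr h4.symm
    refine false_of_four_singular hF hprime.ne_zero (w ∘ ι) (hwind.comp ι ι.injective) (fun i => hws _) (fun i => f (w (ι i)))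
      (fun i => hwc _) ?_ ?_
    · rw [show (∑ i, f (w (ι i)) • (w ∘ ι) i) = b from ?_]; exact hbF
      rw [← hwsum]; exact Equiv.sum_comp ι (fun i => f (w i) • w i)
    · intro j
      rw [show (∑ i, f (w (ι i)) • (w ∘ ι) i) = b from ?_]; exact hbd j
      rw [← hwsum]; exact Equiv.sum_comp ι (fun i => f (w i) • w i)

/-- ★★ **The same, normalised for the ordinary-points machinery**: `B ∈ GL₄(K)`, `S` duplicate-free, a chart choice `c₀` with `B_{c₀(c), c} = 1`, marked
columns singular, every singular vector proportional to a marked column — the input shape of ✓ `MultiOrd.elNatAt_of_ordinaryPoints_matrix₂`.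
[cite: Hartshorne1977, I Ex. 5.8] -/
theorem exists_normalized_matrix_of_singular {F : MvPolynomial (Fin 4) K} (hF : F.IsHomogeneous 3) (hprime : Prime F)
    (hsub : ∀ B : Matrix (Fin 4) (Fin 4) K, IsUnit B.det →
      aeval B.toMvPolynomial F ∉ (Ideal.span {(X 2 : MvPolynomial (Fin 4) K), X 3}) ^ 2) :
    ∃ (B : Matrix (Fin 4) (Fin 4) K) (S : List (Fin 4)) (c₀ : Fin 4 → Fin 4), IsUnit B.det ∧ S.Nodup ∧ (∀ c, B (c₀ c) c = 1) ∧
      (∀ c ∈ S, eval (fun l => B l c) F = 0 ∧ ∀ j, eval (fun l => B l c) (pderiv j F) = 0) ∧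
      ∀ b : Fin 4 → K, b ≠ 0 → eval b F = 0 → (∀ j, eval b (pderiv j F) = 0) → ∃ c ∈ S, ∃ s : K, b = s • fun l => B l c := by
  classical
  obtain ⟨B, S, hB, hS, hsing, hcov⟩ := exists_matrix_of_singular hF hprime hsub
  -- a non-zero entry in every column
  have hex : ∀ j, ∃ l, B l j ≠ 0 := fun j => by
    by_contra h
    push Not at h
    exact col_ne_zero hB j (funext h)
  choose c₀ hc₀ using hex
  set d : Fin 4 → K := fun j => (B (c₀ j) j)⁻¹ with hd
  have hd0 : ∀ j, d j ≠ 0 := fun j => inv_ne_zero (hc₀ j)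
  set B' : Matrix (Fin 4) (Fin 4) K := Matrix.of fun l j => d j * B l j with hB'def
  have hB'eq : B' = B * Matrix.diagonal d := by
    ext l j
    rw [Matrix.mul_diagonal, hB'def, Matrix.of_apply, mul_comm]
  have hB' : IsUnit B'.det := by
    rw [hB'eq, Matrix.det_mul, Matrix.det_diagonal]
    exact hB.mul (IsUnit.mk0 _ (Finset.prod_ne_zero_iff.mpr fun j _ => hd0 j))
  have hcol' : ∀ j, (fun l => B' l j) = d j • fun l => B l j := fun j => by
    funext l; simp [hB'def]
  refine ⟨B', S, c₀, hB', hS, fun c => ?_, fun c hc => ?_, fun b hb0 hbF hbd => ?_⟩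
  · simp only [hB'def, Matrix.of_apply, hd]
    exact inv_mul_cancel₀ (hc₀ c)
  · rw [hcol']
    exact singular_smul hF (d c) (hsing c hc).1 (hsing c hc).2
  · obtain ⟨c, hc, s, rfl⟩ := hcov b hb0 hbF hbd
    refine ⟨c, hc, s * (d c)⁻¹, ?_⟩
    rw [hcol', smul_smul, mul_assoc, inv_mul_cancel₀ (hd0 c), mul_one]

end CubicNodes

end Summit.ResolutionOfSingularities.ResolutionOfSingularities.Cruxes.EquisingularLiftNat.Sections

end
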